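import Literature.NumberTheory.Automorphic.LevelActionCoefficientChange
import Literature.NumberTheory.Automorphic.HidaIndependenceOfWeightTower
import HarnessLib

/-!
# An equivariant isomorphism of coefficients gives isomorphic level-action cohomology

Topic `NumberTheory/Automorphic`; namespace `Literature.NumberTheory.Automorphic.LevelAction`;
definitions with bodies (the isomorphisms) and theorems, continuing `LevelActionCoefficientChange`
(push-forward `f ↦ φ ∘ f` along an equivariant LINEAR MAP of coefficients).  For an equivariant
linear EQUIVALENCE `e : V ≃ V'` between two `Δ`-modules:

* `symm_equivariant` — `e⁻¹` is equivariant;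
* `repIsoOfCoeffEquiv : M(U, τ) ≅ M(U, τ')` (push-forward along `e`, inverse push-forward along
  `e⁻¹`), **`cohomologyIsoOfCoeffEquiv : H^i(U, τ) ≅ H^i(U, τ')`** with
  `cohomologyIsoOfCoeffEquiv_hom` (`=` the push-forward on cohomology);
* `cohomologyIsoOfCoeffEquiv_hom_comp_heckeCohomology`, `bijOn_ordinaryPart_of_coeffEquiv` — Hecke
  operators and `[U α U]`-ordinary parts correspond.

(Transport of structure; used for the definitional identifications between the coefficient
modules of the Hida-theory files.) [cite: KhareThorne2017, §6.4] [cite: Hida1994AIF, §1]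

## References

* C. Khare, J. A. Thorne, Amer. J. Math. 139 (2017), §6.4 (arXiv:1409.7007, held). [KhareThorne2017]
* H. Hida, Ann. Inst. Fourier 44 (1994), §1 (held). [Hida1994AIF]
-/

noncomputable section

open CategoryTheory

universe u

namespace Literature.NumberTheory.Automorphic.LevelAction

variable {R : Type u} [CommRing R] {Γ 𝒢 : Type u} [Group Γ] [Group 𝒢] (ι : Γ →* 𝒢)
  (Δ : Submonoid 𝒢) {V V' : Type u} [AddCommGroup V] [Module R V] [AddCommGroup V'] [Module R V']
  (τ : Δ →* Module.End R V) (τ' : Δ →* Module.End R V') (U : Subgroup 𝒢)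
  (e : V ≃ₗ[R] V') (he : ∀ δ : Δ, (e : V →ₗ[R] V') ∘ₗ τ δ = τ' δ ∘ₗ (e : V →ₗ[R] V'))

include he in
/-- The inverse of an equivariant equivalence is equivariant. [folklore] -/
theorem symm_equivariant (δ : Δ) :
    (e.symm : V' →ₗ[R] V) ∘ₗ τ' δ = τ δ ∘ₗ (e.symm : V' →ₗ[R] V) := by
  refine LinearMap.ext fun v => e.injective ?_
  have h := LinearMap.congr_fun (he δ) (e.symm v)
  simp only [LinearMap.coe_comp, Function.comp_apply, LinearEquiv.coe_coe, LinearEquiv.apply_symm_apply] at h ⊢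
  exact h.symm

/-- **`M(U, τ) ≅ M(U, τ')` along an equivariant isomorphism of coefficients.** [folklore] -/
def repIsoOfCoeffEquiv : Rep.of (rep ι Δ τ U) ≅ Rep.of (rep ι Δ τ' U) where
  hom := pushforward ι Δ τ τ' U (e : V →ₗ[R] V') he
  inv := pushforward ι Δ τ' τ U (e.symm : V' →ₗ[R] V) (symm_equivariant Δ τ τ' e he)
  hom_inv_id := Rep.hom_ext (Representation.IntertwiningMap.ext (LinearMap.ext fun f =>
    Subtype.ext (funext fun g => e.symm_apply_apply (f.1 g))))
  inv_hom_id := Rep.hom_ext (Representation.IntertwiningMap.ext (LinearMap.ext fun f =>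
    Subtype.ext (funext fun g => e.apply_symm_apply (f.1 g))))

/-- **`H^i(U, τ) ≅ H^i(U, τ')` along an equivariant isomorphism of coefficients.**
[cite: KhareThorne2017, §6.4] -/
def cohomologyIsoOfCoeffEquiv (i : ℕ) : cohomology ι Δ τ U i ≅ cohomology ι Δ τ' U i :=
  (groupCohomology.functor R Γ i).mapIso (repIsoOfCoeffEquiv ι Δ τ τ' U e he)

/-- The isomorphism on cohomology is the push-forward along `e`. [folklore] -/
theorem cohomologyIsoOfCoeffEquiv_hom (i : ℕ) :
    (cohomologyIsoOfCoeffEquiv ι Δ τ τ' U e he i).hom = pushforwardCohomology ι Δ τ τ' U (e : V →ₗ[R] V') he i :=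
  rfl

/-- **Hecke operators correspond.** [folklore] -/
theorem cohomologyIsoOfCoeffEquiv_hom_comp_heckeCohomology (hU : U.toSubmonoid ≤ Δ) {β : 𝒢} (hβ : β ∈ Δ)
    (i : ℕ) :
    (cohomologyIsoOfCoeffEquiv ι Δ τ τ' U e he i).hom.hom ∘ₗ heckeCohomology ι Δ τ U hU hβ i =
      heckeCohomology ι Δ τ' U hU hβ i ∘ₗ (cohomologyIsoOfCoeffEquiv ι Δ τ τ' U e he i).hom.hom := by
  rw [cohomologyIsoOfCoeffEquiv_hom]
  exact heckeCohomology_comp_pushforwardCohomology ι Δ τ τ' U _ he hU hβ i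

/-- **The `[U β U]`-ordinary parts correspond.** [folklore] -/
theorem bijOn_ordinaryPart_of_coeffEquiv (hU : U.toSubmonoid ≤ Δ) {β : 𝒢} (hβ : β ∈ Δ) (i : ℕ) :
    Set.BijOn (cohomologyIsoOfCoeffEquiv ι Δ τ τ' U e he i).hom.hom
      (⨅ n : ℕ, LinearMap.range (heckeCohomology ι Δ τ U hU hβ i ^ n) : Submodule R _)
      (⨅ n : ℕ, LinearMap.range (heckeCohomology ι Δ τ' U hU hβ i ^ n) : Submodule R _) :=
  bijOn_iInf_range_pow_of_linearEquiv (cohomologyIsoOfCoeffEquiv ι Δ τ τ' U e he i).toLinearEquiv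
    (cohomologyIsoOfCoeffEquiv_hom_comp_heckeCohomology ι Δ τ τ' U e he hU hβ i)

end Literature.NumberTheory.Automorphic.LevelAction
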